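import Summits.ABC.ABC.Theorems.DefiniteXiDefiniteRTControlPrimeCyclicCharacterAtEll
import HarnessLib

/-!
# Crux `DefiniteRTControlPrime` from Takahashi 2.3 alone — part 3/7: weight pinning at `ℓ` and the GLOBAL dichotomy

`eq_one_or_eq_cyclotomic_of_container` / `cyclicCharacter_eq_one_or_eq_cyclotomic_at_ell` (LOCℓ: on inertia at
`𝔓 ∣ ℓ`, `r = 1` or `r = χ_cyc` exactly), then the global exponent-12 dichotomy at half level
`unitsMap_cyclicCharacter_pow_twelve_dichotomy` (GLOB⁻): for `W/ℚ` global minimal, semistable at every `v ∣ ℓ`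
(`ℓ` odd), a stable line of order `ℓᵏ` has character `r` with `r¹² = 1` or `r¹² = χ¹²` modulo `ℓ^⌈k/2⌉` —
potentially good places by the exponent `12` of `Φ`, multiplicative places by part 1, places over `ℓ` by LOCℓ,
and `ℚ` has no everywhere-unramified characters (Minkowski).  Continues `DefiniteXiDefiniteRTControlPrimeCyclicCharacterAtEll`.

Origin: crux programme of stmt-ABC-11338, kernel certificate `Cruxes/DefiniteRTControlPrime/StubIdeasK2G11CruxFromTakahashi.lean` (stub-ideation k2, gens 2–11; farm `lean check` rc 0, 0 sorries, axioms propext/Classical.choice/Quot.sound), re-packaged verbatim into seven `≤ 400`-line modules by k2 gen 12 (namespaces `…Theorems.DefiniteRTControlPrime.CyclicCharacter` / `.OfTakahashi`; statements and proofs unchanged).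

## References

* [Mazur1978] B. Mazur, Rational isogenies of prime degree, Invent. Math. 44 (1978) 129–162, §5 (isogeny characters), Lemma 5.2–5.4.
* [Serre1972] J.-P. Serre, Propriétés galoisiennes des points d'ordre fini des courbes elliptiques, Invent. Math. 15 (1972), §1.11–1.12, §5.4 Prop. 21.
* [SilvermanATAEC1994] J. H. Silverman, Advanced Topics in the Arithmetic of Elliptic Curves, GTM 151, Thm. V.5.3, Cor. V.5.4, Prop. V.6.1 (Tate curve, Galois action).
* [Takahashi2001] S. Takahashi, Degrees of parametrizations of elliptic curves by Shimura curves, J. Number Theory 90 (2001) 74–88, Thm. 2.3 (p. 79).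
* [PastenShimura2024] H. Pasten, Shimura curves and the abc conjecture, J. Number Theory 254 (2024) 214–335 = arXiv:1705.09251, §3 p. 13, §6.4, Lemma 6.8.
-/

set_option linter.dupNamespace false

namespace Summit.ABC.ABC.Theorems.DefiniteRTControlPrime.CyclicCharacter

open Literature.NumberTheory.EllipticCurves Literature.NumberTheory.EllipticCurves.ModularForms
open Literature.NumberTheory.GaloisRepresentations Literature.NumberTheory.EllipticCurves.TateCurve
open WeierstrassCurve IsDedekindDomain IsDedekindDomain.HeightOneSpectrum NumberField Field
open scoped NumberField NNReal Classical

section LOCell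

open Rat.HeightOneSpectrum


/-- **H2 (PROVED here).**  A two-clause container at `𝔓` for the inertia group `I_𝔓` (`𝔓 ∣ ℓ`,
`ℓ` odd, `k ≥ 1`) forces the character of a stable cyclic line of order `ℓᵏ` to be EXACTLY `1` or
EXACTLY `χ_{ℓᵏ}` on `I_𝔓`: D1 with `x := χ(τ).val`, `y := 1`, `lam := r(τ).val`, witness `τ₀ ∈ I_𝔓`
with `χ_{ℓᵏ}(τ₀) = 2` (`exists_mem_inertia_modNCyclotomicCharacter_eq`; `2 − 1 = 1` is prime to `ℓ`). -/
theorem eq_one_or_eq_cyclotomic_of_container (W : WeierstrassCurve ℚ) [W.IsElliptic]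
    {ℓ k : ℕ} [Fact ℓ.Prime] (hℓ2 : ℓ ≠ 2) (hk : 1 ≤ k)
    {v : HeightOneSpectrum (𝓞 ℚ)} (hℓv : (ℓ : 𝓞 ℚ) ∈ v.asIdeal)
    {𝔓 : Ideal (absIntegers (𝓞 ℚ) ℚ)} (h𝔓 : 𝔓 ∈ v.primesAbove)
    (E₁ : AddSubgroup (geomPoints W))
    (h1 : ∀ τ ∈ 𝔓.inertia (absoluteGaloisGroup ℚ), ∀ Q ∈ E₁, ℓ ^ k • Q = 0 →
        τ • Q = ((((modNCyclotomicCharacter ℚ (ℓ ^ k) τ : (ZMod (ℓ ^ k))ˣ) :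
          ZMod (ℓ ^ k)).val : ℤ)) • Q)
    (h2 : ∀ τ ∈ 𝔓.inertia (absoluteGaloisGroup ℚ), ∀ Q : geomPoints W, ℓ ^ k • Q = 0 →
        τ • Q - Q ∈ E₁)
    {P : geomPoints W} (hP : addOrderOf P = ℓ ^ k)
    {r : absoluteGaloisGroup ℚ →* (ZMod (ℓ ^ k))ˣ}
    (hr : ∀ σ : absoluteGaloisGroup ℚ, σ • P = ((r σ : (ZMod (ℓ ^ k))ˣ) : ZMod (ℓ ^ k)).val • P) :
    (∀ τ ∈ 𝔓.inertia (absoluteGaloisGroup ℚ), r τ = 1) ∨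
      (∀ τ ∈ 𝔓.inertia (absoluteGaloisGroup ℚ), r τ = modNCyclotomicCharacter ℚ (ℓ ^ k) τ) := by
  have hℓ : ℓ.Prime := Fact.out
  haveI : NeZero (ℓ ^ k) := ⟨pow_ne_zero _ hℓ.ne_zero⟩
  have hℓ3 : 3 ≤ ℓ := by
    rcases hℓ.eq_two_or_odd' with h | h
    · exact absurd h hℓ2
    · have := hℓ.two_le; omega
  have hlt2 : 2 < ℓ ^ k := lt_of_lt_of_le (by omega) (Nat.le_self_pow (by omega) ℓ |>.trans
    (Nat.pow_le_pow_right hℓ.pos hk))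
  set I := 𝔓.inertia (absoluteGaloisGroup ℚ) with hI
  set χ := modNCyclotomicCharacter ℚ (ℓ ^ k) with hχ
  -- the witness `τ₀ ∈ I` with `χ(τ₀) = 2`
  have hcop : Nat.Coprime 2 (ℓ ^ k) := (Nat.coprime_pow_right_iff hk _ _).mpr
    ((Nat.coprime_primes Nat.prime_two hℓ).mpr (Ne.symm hℓ2))
  set a : (ZMod (ℓ ^ k))ˣ := ZMod.unitOfCoprime 2 hcop with ha
  have hkm : ℓ ^ k = ℓ ^ (k - 1 + 1) * 1 := by rw [Nat.sub_add_cancel hk, mul_one]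
  obtain ⟨τ₀, hτ₀I, hτ₀⟩ := exists_mem_inertia_modNCyclotomicCharacter_eq (m := ℓ ^ k) (p := ℓ)
    (k := k - 1) (d := 1) hkm (fun h1 => hℓ.one_lt.ne' (Nat.dvd_one.mp h1))
    (natGenerator_eq_of_natCast_mem v hℓ hℓv) h𝔓 (a := a) (Subsingleton.elim _ _)
  have haval : ((a : (ZMod (ℓ ^ k))ˣ) : ZMod (ℓ ^ k)).val = 2 := by
    rw [ha, ZMod.coe_unitOfCoprime, ZMod.val_natCast, Nat.mod_eq_of_lt hlt2]
  -- D1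
  have hD := filtration_dichotomy (M := geomPoints W) hℓ E₁ (ι := I)
    (fun i => DistribSMul.toAddMonoidHom (geomPoints W) (i : absoluteGaloisGroup ℚ))
    (fun i => (((χ i : (ZMod (ℓ ^ k))ˣ) : ZMod (ℓ ^ k)).val : ℤ)) (fun _ => 1)
    (fun i Q hQ hQk => h1 i i.2 Q hQ hQk)
    (fun i Q hQk => by rw [one_zsmul]; exact h2 i i.2 Q hQk)
    ⟨τ₀, hτ₀I⟩ (by
      change ¬ ((ℓ : ℤ) ∣ (((χ τ₀ : (ZMod (ℓ ^ k))ˣ) : ZMod (ℓ ^ k)).val : ℤ) - 1)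
      rw [← hχ] at hτ₀
      rw [hτ₀, haval]
      norm_num
      intro h
      exact hℓ.one_lt.ne' (by exact_mod_cast Int.eq_one_of_dvd_one (by positivity) h))
    hP (fun i => (((r i : (ZMod (ℓ ^ k))ˣ) : ZMod (ℓ ^ k)).val : ℤ))
    (fun i => by
      change (i : absoluteGaloisGroup ℚ) • P = _
      rw [hr, natCast_zsmul])
  -- read the divisibilities back in `(ZMod ℓᵏ)ˣ`
  have hread : ∀ (u w : (ZMod (ℓ ^ k))ˣ),
      (ℓ : ℤ) ^ k ∣ (((u : ZMod (ℓ ^ k)).val : ℤ)) - (((w : ZMod (ℓ ^ k)).val : ℤ)) → u = w := by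
    intro u w h
    have h' : ((((w : ZMod (ℓ ^ k)).val : ℤ) : ZMod (ℓ ^ k))) =
        ((((u : ZMod (ℓ ^ k)).val : ℤ) : ZMod (ℓ ^ k))) := by
      rw [ZMod.intCast_eq_intCast_iff_dvd_sub]
      exact_mod_cast h
    apply Units.ext
    rw [Int.cast_natCast, Int.cast_natCast, ZMod.natCast_zmod_val, ZMod.natCast_zmod_val] at h'
    exact h'.symm
  rcases hD with hD | hD
  · left
    intro τ hτ
    have h := hD ⟨τ, hτ⟩
    haveI : Fact (1 < ℓ ^ k) := ⟨by omega⟩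
    refine hread (r τ) 1 ?_
    rw [Units.val_one, ZMod.val_one, Nat.cast_one]
    exact h
  · right
    intro τ hτ
    exact hread (r τ) (χ τ) (hD ⟨τ, hτ⟩)

/-- **LOCℓ (PROVED here, g7/g9 signature verbatim).**  `W` globally minimal, semistable at `v ∣ ℓ`,
`ℓ` odd, `k ≥ 1`: the character of a stable cyclic line of order `ℓᵏ` is EXACTLY `1` or EXACTLY
`χ_{ℓᵏ}` on `I_𝔓` for every `𝔓 ∣ ℓ`.  Multiplicative ⇒ D3′₀; good ⇒ SS′ on `ℓ^{k−1}P` excludes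
supersingular, then D2₀; H2 at `𝔓₀`; CONJ moves to `𝔓`. -/
theorem cyclicCharacter_eq_one_or_eq_cyclotomic_at_ell (W : WeierstrassCurve ℚ) [W.IsElliptic]
    [W.IsGloballyMinimal] (ℓ k : ℕ) [Fact ℓ.Prime] (hℓ2 : ℓ ≠ 2) (hk : 1 ≤ k)
    {v : HeightOneSpectrum (𝓞 ℚ)} (hℓv : (ℓ : 𝓞 ℚ) ∈ v.asIdeal) (hss : W.IsSemistableAt v)
    {P : geomPoints W} (hP : addOrderOf P = ℓ ^ k)
    {r : absoluteGaloisGroup ℚ →* (ZMod (ℓ ^ k))ˣ}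
    (hr : ∀ σ : absoluteGaloisGroup ℚ, σ • P = ((r σ : (ZMod (ℓ ^ k))ˣ) : ZMod (ℓ ^ k)).val • P)
    {𝔓 : Ideal (absIntegers (𝓞 ℚ) ℚ)} (h𝔓 : 𝔓 ∈ v.primesAbove) :
    (∀ τ ∈ 𝔓.inertia (absoluteGaloisGroup ℚ), r τ = 1) ∨
      (∀ τ ∈ 𝔓.inertia (absoluteGaloisGroup ℚ), r τ = modNCyclotomicCharacter ℚ (ℓ ^ k) τ) := by
  have hℓ : ℓ.Prime := Fact.out
  haveI : NeZero (ℓ ^ k) := ⟨pow_ne_zero _ hℓ.ne_zero⟩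
  haveI : NeZero ((ℓ ^ k : ℕ) : v.adicCompletion ℚ) :=
    NeZero.nat_of_injective (algebraMap ℚ (v.adicCompletion ℚ)).injective
  have hℓ3 : 3 ≤ ℓ := by
    rcases hℓ.eq_two_or_odd' with h | h
    · exact absurd h hℓ2
    · have := hℓ.two_le; omega
  have h𝔓₀ := adicCompletionPrime_mem_primesAbove ℚ v
  -- the container at `𝔓₀`
  obtain ⟨E₁, h1, h2⟩ : ∃ E₁ : AddSubgroup (geomPoints W),
      (∀ τ ∈ (adicCompletionPrime ℚ v).inertia (absoluteGaloisGroup ℚ), ∀ Q ∈ E₁, ℓ ^ k • Q = 0 →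
        τ • Q = ((((modNCyclotomicCharacter ℚ (ℓ ^ k) τ : (ZMod (ℓ ^ k))ˣ) :
          ZMod (ℓ ^ k)).val : ℤ)) • Q) ∧
      (∀ τ ∈ (adicCompletionPrime ℚ v).inertia (absoluteGaloisGroup ℚ), ∀ Q : geomPoints W,
        ℓ ^ k • Q = 0 → τ • Q - Q ∈ E₁) := by
    rcases hss with hgood | hmult
    · -- good reduction: SS′ on `ℓ^{k-1} P` excludes supersingular, then D2₀
      have hgoodℓ : W.HasGoodReductionAtPrime ℓ := W.hasGoodReductionAtPrime_of_hasGoodReductionAt v hℓv hgood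
      -- `Q := ℓ^{k-1} P ∈ E[ℓ]`, nonzero, with character `r mod ℓ`
      have hℓQ : ℓ • (ℓ ^ (k - 1) • P) = 0 := by
        rw [← mul_nsmul', ← pow_succ', Nat.sub_add_cancel hk, ← hP]; exact addOrderOf_nsmul_eq_zero P
      have hQmem : ℓ ^ (k - 1) • P ∈ geomTorsion W ℓ := by
        refine (mem_torsionPoints_iff _ _ _).mpr ?_
        rw [natCast_zsmul]
        exact hℓQ
      set Q : geomTorsion W ℓ := ⟨ℓ ^ (k - 1) • P, hQmem⟩ with hQdef
      have hQ0 : Q ≠ 0 := by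
        intro h0
        have h0' : ℓ ^ (k - 1) • P = 0 := by
          have := congrArg Subtype.val h0
          simpa [hQdef] using this
        have hd : ℓ ^ k ∣ ℓ ^ (k - 1) := by rw [← hP]; exact addOrderOf_dvd_of_nsmul_eq_zero h0'
        have := (Nat.pow_dvd_pow_iff_le_right hℓ.one_lt).mp hd
        omega
      have hdvd : ℓ ∣ ℓ ^ k := dvd_pow_self ℓ (by omega)
      set r₁ : absoluteGaloisGroup ℚ →* (ZMod ℓ)ˣ := (ZMod.unitsMap hdvd).comp r with hr₁def
      have hr₁ : ∀ σ : absoluteGaloisGroup ℚ, σ • Q = ((r₁ σ : (ZMod ℓ)ˣ) : ZMod ℓ).val • Q := by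
        intro σ
        apply Subtype.ext
        rw [AddSubgroup.torsionBy.coe_smul, AddSubgroupClass.coe_nsmul]
        change σ • (ℓ ^ (k - 1) • P) = ((r₁ σ : (ZMod ℓ)ˣ) : ZMod ℓ).val • (ℓ ^ (k - 1) • P)
        have hcast : (((r₁ σ : (ZMod ℓ)ˣ) : ZMod ℓ)) =
            ZMod.castHom hdvd (ZMod ℓ) ((r σ : (ZMod (ℓ ^ k))ˣ) : ZMod (ℓ ^ k)) := rfl
        rw [smul_comm, hr σ, smul_comm, hcast, ZMod.castHom_apply, ZMod.cast_eq_val, ZMod.val_natCast,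
          ← nsmul_eq_mod_nsmul _ hℓQ]
      have hord := not_dvd_frobeniusTrace_of_isogenyCharacter W ℓ hℓ3 hgoodℓ hQ0 hr₁
      have hord' : ¬ ((ℓ : ℤ) ∣ W.frobeniusTraceAt v) := by
        rw [frobeniusTraceAt_eq_frobeniusTrace]
        have hpe : (primesEquiv v : ℕ) = ℓ := primesEquiv_eq_of_natCast_mem v hℓ hℓv
        rwa [hpe]
      exact exists_ordinaryFiltration_adicCompletionPrime W hgood hℓv hord' k
    · exact exists_multiplicativeFiltration_adicCompletionPrime W hmult hℓv k
  -- dichotomy at `𝔓₀`, then CONJ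
  rcases eq_one_or_eq_cyclotomic_of_container W hℓ2 hk hℓv h𝔓₀ E₁ h1 h2 hP hr with h | h
  · left
    intro τ hτ
    have := eqOn_inertia_of_eqOn_inertia_one r 1 v h𝔓₀ (by simpa using h) h𝔓 hτ
    simpa using this
  · right
    intro τ hτ
    exact eqOn_inertia_of_eqOn_inertia_one r (modNCyclotomicCharacter ℚ (ℓ ^ k)) v h𝔓₀ h h𝔓 hτ

end LOCell

/-! ## §6 GLOB⁻ ASSEMBLED (gen 11): LOC (g9: T1⁺ + T2, T2 now PROVED §4) + LOCℓ (§5) + OPEN + Minkowski -/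

section GLOB

open Rat.HeightOneSpectrum

/-- T1⁺ (g9 verbatim, proved). -/
theorem cyclicCharacter_pow_twelve_eq_one_of_valuation_j_le_one (W : WeierstrassCurve ℚ)
    [W.IsElliptic] {m : ℕ} [NeZero m] {P : geomPoints W} (hP : addOrderOf P = m)
    {r : absoluteGaloisGroup ℚ →* (ZMod m)ˣ}
    (hr : ∀ σ : absoluteGaloisGroup ℚ, σ • P = ((r σ : (ZMod m)ˣ) : ZMod m).val • P)
    {v : HeightOneSpectrum (𝓞 ℚ)} (hmv : (m : 𝓞 ℚ) ∉ v.asIdeal) (hj : v.valuation ℚ W.j ≤ 1)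
    {𝔓 : Ideal (absIntegers (𝓞 ℚ) ℚ)} (h𝔓 : 𝔓 ∈ v.primesAbove)
    {τ : absoluteGaloisGroup ℚ} (hτ : τ ∈ 𝔓.inertia (absoluteGaloisGroup ℚ)) :
    r τ ^ 12 = 1 := by
  have hmP : m • P = 0 := by rw [← hP]; exact addOrderOf_nsmul_eq_zero P
  have h12 : τ ^ 12 • P = P := by
    by_cases h3 : (3 : 𝓞 ℚ) ∈ v.asIdeal
    · have h2 : (2 : 𝓞 ℚ) ∉ v.asIdeal := by
        intro h2
        have h1 : (1 : 𝓞 ℚ) ∈ v.asIdeal := by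
          have h := v.asIdeal.sub_mem h3 h2
          norm_num at h
          exact h
        exact v.isPrime.ne_top ((Ideal.eq_top_iff_one _).mpr h1)
      exact Mazur1978.pow_twelve_smul_eq_of_mem_inertia_of_valuation_j_le_one W h2 hj h𝔓 hτ hmv hmP
    · exact Mazur1978.pow_twelve_smul_eq_of_mem_inertia_of_valuation_j_le_one_of_three W h3 hj h𝔓 hτ
        hmv hmP
  have h' : ((r (τ ^ 12) : (ZMod m)ˣ) : ZMod m).val • P = P := by rw [← hr]; exact h12
  have h1 : ((r (τ ^ 12) : (ZMod m)ˣ) : ZMod m) = 1 :=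
    Mazur1978.eq_one_of_val_smul_eq_of_addOrderOf W hP h'
  rw [map_pow] at h1
  exact Units.val_eq_one.mp h1

/-- **LOC (g9 statement; PROVED — unconditionally now that T2 (§4) is).**  At every place `v ∤ ℓ`, the
half-level character of a stable cyclic line of order `ℓᵏ` satisfies `r̄(τ)¹² = 1` on inertia. -/
theorem unitsMap_cyclicCharacter_pow_twelve_eq_one (W : WeierstrassCurve ℚ) [W.IsElliptic]
    {ℓ k : ℕ} [Fact ℓ.Prime] (hk : 1 ≤ k) {P : geomPoints W} (hP : addOrderOf P = ℓ ^ k)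
    {r : absoluteGaloisGroup ℚ →* (ZMod (ℓ ^ k))ˣ}
    (hr : ∀ σ : absoluteGaloisGroup ℚ, σ • P = ((r σ : (ZMod (ℓ ^ k))ˣ) : ZMod (ℓ ^ k)).val • P)
    {v : HeightOneSpectrum (𝓞 ℚ)} (hℓv : (ℓ : 𝓞 ℚ) ∉ v.asIdeal)
    {𝔓 : Ideal (absIntegers (𝓞 ℚ) ℚ)} (h𝔓 : 𝔓 ∈ v.primesAbove)
    {τ : absoluteGaloisGroup ℚ} (hτ : τ ∈ 𝔓.inertia (absoluteGaloisGroup ℚ)) :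
    ZMod.unitsMap (pow_halfCeil_dvd ℓ k) (r τ) ^ 12 = 1 := by
  haveI : NeZero (ℓ ^ k) := ⟨pow_ne_zero _ (Fact.out : ℓ.Prime).ne_zero⟩
  rcases le_or_gt (v.valuation ℚ W.j) 1 with hj | hj
  · have hmv : ((ℓ ^ k : ℕ) : 𝓞 ℚ) ∉ v.asIdeal := by
      rw [Nat.cast_pow]
      exact fun h => hℓv (v.isPrime.mem_of_pow_mem k h)
    have h12 := cyclicCharacter_pow_twelve_eq_one_of_valuation_j_le_one W hP hr hmv hj h𝔓 hτ
    rw [← map_pow, h12, map_one]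
  · have h2 := unitsMap_cyclicCharacter_sq_eq_one_of_one_lt_valuation_j W hj hℓv hk hP hr h𝔓 hτ
    calc ZMod.unitsMap (pow_halfCeil_dvd ℓ k) (r τ) ^ 12
        = (ZMod.unitsMap (pow_halfCeil_dvd ℓ k) (r τ) ^ 2) ^ 6 := by rw [← pow_mul]
      _ = 1 := by rw [h2, one_pow]

/-- OPEN (g9 verbatim, proved): the character of a stable cyclic line has open kernel. -/
theorem isOpen_ker_of_smul_eq_of_addOrderOf (W : WeierstrassCurve ℚ) [W.IsElliptic] {m : ℕ}
    [NeZero m] {P : geomPoints W} (hP : addOrderOf P = m)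
    {r : absoluteGaloisGroup ℚ →* (ZMod m)ˣ}
    (hr : ∀ σ : absoluteGaloisGroup ℚ, σ • P = ((r σ : (ZMod m)ˣ) : ZMod m).val • P) :
    IsOpen ((r.ker : Subgroup (absoluteGaloisGroup ℚ)) : Set (absoluteGaloisGroup ℚ)) := by
  refine Subgroup.isOpen_mono (H₁ := MulAction.stabilizer (absoluteGaloisGroup ℚ) P) ?_
    (isOpen_stabilizer_point_holds W P)
  intro σ hσ
  rw [MulAction.mem_stabilizer_iff] at hσ
  rw [MonoidHom.mem_ker]
  have hfix : ((r σ : (ZMod m)ˣ) : ZMod m).val • P = P := by rw [← hr σ]; exact hσ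
  exact Units.val_eq_one.mp (Mazur1978.eq_one_of_val_smul_eq_of_addOrderOf W hP hfix)

/-- **GLOB⁻ (PROVED here, g9 signature verbatim).**  `W` globally minimal, semistable above `ℓ`,
`ℓ` odd, `k ≥ 1`, `ℤP` stable of order `ℓᵏ` with character `r`; `r̄ := r mod ℓ^⌈k/2⌉`,
`χ̄ := χ_{ℓ^⌈k/2⌉}`.  Then `r̄¹² = 1` OR `r̄¹² = χ̄¹²` on all of `Γ_ℚ`: LOCℓ (§5) picks the branch at the
place of `ℓ`, `ψ := r̄¹²` resp. `((r·χ⁻¹) mod ℓ^⌈k/2⌉)¹²` is trivial on every inertia group (LOC off `ℓ`,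
`χ` unramified off `ℓ`, CONJ above `ℓ`), has open kernel (OPEN, `isOpen_ker_modNCyclotomicCharacter`),
hence is trivial (Minkowski: `Mazur1978.monoidHom_eq_one_of_forall_inertia`). -/
theorem unitsMap_cyclicCharacter_pow_twelve_dichotomy (W : WeierstrassCurve ℚ) [W.IsElliptic]
    [W.IsGloballyMinimal] (ℓ k : ℕ) [Fact ℓ.Prime] (hℓ2 : ℓ ≠ 2) (hk : 1 ≤ k)
    (hss : ∀ v : HeightOneSpectrum (𝓞 ℚ), (ℓ : 𝓞 ℚ) ∈ v.asIdeal → W.IsSemistableAt v)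
    {P : geomPoints W} (hP : addOrderOf P = ℓ ^ k)
    {r : absoluteGaloisGroup ℚ →* (ZMod (ℓ ^ k))ˣ}
    (hr : ∀ σ : absoluteGaloisGroup ℚ, σ • P = ((r σ : (ZMod (ℓ ^ k))ˣ) : ZMod (ℓ ^ k)).val • P) :
    (∀ σ : absoluteGaloisGroup ℚ, ZMod.unitsMap (pow_halfCeil_dvd ℓ k) (r σ) ^ 12 = 1) ∨
      (∀ σ : absoluteGaloisGroup ℚ, ZMod.unitsMap (pow_halfCeil_dvd ℓ k) (r σ) ^ 12 =
        modNCyclotomicCharacter ℚ (ℓ ^ halfCeil k) σ ^ 12) := by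
  have hℓ : ℓ.Prime := Fact.out
  haveI : NeZero (ℓ ^ k) := ⟨pow_ne_zero _ hℓ.ne_zero⟩
  haveI : NeZero (ℓ ^ halfCeil k) := ⟨pow_ne_zero _ hℓ.ne_zero⟩
  -- the place `v₀` of `ℓ` and the prime `𝔓₀` of `ℚ̄` above it
  set v₀ : HeightOneSpectrum (𝓞 ℚ) := primesEquiv.symm ⟨ℓ, hℓ⟩ with hv₀def
  have hv₀ : (primesEquiv v₀ : ℕ) = ℓ := by rw [hv₀def, Equiv.apply_symm_apply]
  have hgen : natGenerator v₀ = ℓ := hv₀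
  have hℓv₀ : (ℓ : 𝓞 ℚ) ∈ v₀.asIdeal := by
    have h := natCast_natGenerator_mem v₀
    rwa [hgen] at h
  have huniq : ∀ v : HeightOneSpectrum (𝓞 ℚ), (ℓ : 𝓞 ℚ) ∈ v.asIdeal → v = v₀ := fun v hv =>
    primesEquiv.injective (Subtype.ext ((primesEquiv_eq_of_natCast_mem v hℓ hv).trans hv₀.symm))
  have h𝔓₀ := adicCompletionPrime_mem_primesAbove ℚ v₀
  -- LOC off `ℓ`, OPEN
  have hloc : ∀ v : HeightOneSpectrum (𝓞 ℚ), (ℓ : 𝓞 ℚ) ∉ v.asIdeal → ∀ 𝔓 ∈ v.primesAbove,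
      ∀ τ ∈ 𝔓.inertia (absoluteGaloisGroup ℚ), ZMod.unitsMap (pow_halfCeil_dvd ℓ k) (r τ) ^ 12 = 1 :=
    fun v hv 𝔓 h𝔓 τ hτ => unitsMap_cyclicCharacter_pow_twelve_eq_one W hk hP hr hv h𝔓 hτ
  have hker := isOpen_ker_of_smul_eq_of_addOrderOf W hP hr
  rcases cyclicCharacter_eq_one_or_eq_cyclotomic_at_ell W ℓ k hℓ2 hk hℓv₀ (hss v₀ hℓv₀) hP hr h𝔓₀
    with hA | hB
  · left
    set ψ : absoluteGaloisGroup ℚ →* (ZMod (ℓ ^ halfCeil k))ˣ :=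
      (powMonoidHom 12).comp ((ZMod.unitsMap (pow_halfCeil_dvd ℓ k)).comp r) with hψ
    have hψ' : ∀ σ, ψ σ = ZMod.unitsMap (pow_halfCeil_dvd ℓ k) (r σ) ^ 12 := fun σ => rfl
    have hψker : IsOpen ((ψ.ker : Subgroup (absoluteGaloisGroup ℚ)) : Set (absoluteGaloisGroup ℚ)) := by
      refine Subgroup.isOpen_mono (H₁ := r.ker) ?_ hker
      intro σ hσ
      rw [MonoidHom.mem_ker] at hσ ⊢
      rw [hψ', hσ, map_one, one_pow]
    have hψI : ∀ (v : HeightOneSpectrum (𝓞 ℚ)), ∀ 𝔓 ∈ v.primesAbove,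
        ∀ τ ∈ 𝔓.inertia (absoluteGaloisGroup ℚ), ψ τ = 1 := by
      intro v 𝔓 h𝔓 τ hτ
      by_cases hv : (ℓ : 𝓞 ℚ) ∈ v.asIdeal
      · obtain rfl := huniq v hv
        have h1 : r τ = 1 := by
          have := eqOn_inertia_of_eqOn_inertia_one r 1 _ h𝔓₀ (by simpa using hA) h𝔓 hτ
          simpa using this
        rw [hψ', h1, map_one, one_pow]
      · rw [hψ']; exact hloc v hv 𝔓 h𝔓 τ hτ
    have hψ1 := Mazur1978.monoidHom_eq_one_of_forall_inertia ψ hψker hψI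
    intro σ
    have h1 := DFunLike.congr_fun hψ1 σ
    rw [MonoidHom.one_apply, hψ'] at h1
    exact h1
  · right
    set χ : absoluteGaloisGroup ℚ →* (ZMod (ℓ ^ k))ˣ := modNCyclotomicCharacter ℚ (ℓ ^ k) with hχ
    set ψ : absoluteGaloisGroup ℚ →* (ZMod (ℓ ^ halfCeil k))ˣ :=
      (powMonoidHom 12).comp ((ZMod.unitsMap (pow_halfCeil_dvd ℓ k)).comp (r * χ⁻¹)) with hψ
    have hψ' : ∀ σ, ψ σ = (ZMod.unitsMap (pow_halfCeil_dvd ℓ k) (r σ) *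
        (ZMod.unitsMap (pow_halfCeil_dvd ℓ k) (χ σ))⁻¹) ^ 12 := by
      intro σ
      change (ZMod.unitsMap (pow_halfCeil_dvd ℓ k) ((r * χ⁻¹) σ)) ^ 12 = _
      rw [MonoidHom.mul_apply, MonoidHom.inv_apply, map_mul, map_inv]
    have hχbar : ∀ σ, ZMod.unitsMap (pow_halfCeil_dvd ℓ k) (χ σ) =
        modNCyclotomicCharacter ℚ (ℓ ^ halfCeil k) σ :=
      fun σ => Mazur1978.unitsMap_modNCyclotomicCharacter _ σ
    have hψker : IsOpen ((ψ.ker : Subgroup (absoluteGaloisGroup ℚ)) : Set (absoluteGaloisGroup ℚ)) := by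
      refine Subgroup.isOpen_mono (H₁ := r.ker ⊓ χ.ker) ?_ ?_
      · intro σ hσ
        rw [Subgroup.mem_inf, MonoidHom.mem_ker, MonoidHom.mem_ker] at hσ
        rw [MonoidHom.mem_ker, hψ', hσ.1, hσ.2, map_one, inv_one, mul_one, one_pow]
      · rw [Subgroup.coe_inf]
        exact hker.inter (Mazur1978.isOpen_ker_modNCyclotomicCharacter (ℓ ^ k))
    have hψI : ∀ (v : HeightOneSpectrum (𝓞 ℚ)), ∀ 𝔓 ∈ v.primesAbove,
        ∀ τ ∈ 𝔓.inertia (absoluteGaloisGroup ℚ), ψ τ = 1 := by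
      intro v 𝔓 h𝔓 τ hτ
      haveI := h𝔓.1
      by_cases hv : (ℓ : 𝓞 ℚ) ∈ v.asIdeal
      · obtain rfl := huniq v hv
        have h1 : r τ = χ τ := eqOn_inertia_of_eqOn_inertia_one r χ _ h𝔓₀ hB h𝔓 hτ
        rw [hψ', h1, mul_inv_cancel, one_pow]
      · have hmv : ((ℓ ^ k : ℕ) : 𝓞 ℚ) ∉ v.asIdeal := by
          rw [Nat.cast_pow]
          exact fun h => hv (v.isPrime.mem_of_pow_mem k h)
        have hχ1 : χ τ = 1 :=
          modNCyclotomicCharacter_eq_one_of_mem_inertia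
            (Mazur1978.natCast_not_mem_of_not_mem_asIdeal hmv h𝔓) hτ
        rw [hψ', hχ1, map_one, inv_one, mul_one]
        exact hloc v hv 𝔓 h𝔓 τ hτ
    have hψ1 := Mazur1978.monoidHom_eq_one_of_forall_inertia ψ hψker hψI
    intro σ
    have h1 := DFunLike.congr_fun hψ1 σ
    rw [MonoidHom.one_apply, hψ', hχbar σ, mul_pow, inv_pow, mul_inv_eq_one] at h1
    exact h1

end GLOB

end Summit.ABC.ABC.Theorems.DefiniteRTControlPrime.CyclicCharacter
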